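import Summits.BirchSwinnertonDyer.BirchSwinnertonDyer.Theorems.ByReductionTypeAtTwoOrdKatoHalfAtTwoIsoValueInputTwo
import Summits.BirchSwinnertonDyer.BirchSwinnertonDyer.Theorems.ByReductionTypeAtTwoOrdKatoHalfAtTwoIsoKolyvaginCocycleNoTransverse
import Summits.BirchSwinnertonDyer.BirchSwinnertonDyer.Theorems.ByReductionTypeAtTwoOrdKatoHalfAtTwoIsoKThreeValueLine
import Summits.BirchSwinnertonDyer.BirchSwinnertonDyer.Theorems.ByReductionTypeAtTwoOrdKatoHalfAtTwoIsoRedTowerUnramifiedTwo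
import Summits.BirchSwinnertonDyer.BirchSwinnertonDyer.Theorems.ByReductionTypeAtTwoOrdKatoHalfAtTwoIsoLocalFrobeniusTransposition
import Summits.BirchSwinnertonDyer.BirchSwinnertonDyer.Theorems.ByReductionTypeAtTwoOrdKatoHalfAtTwoIsoPortGaloisSide
import Summits.BirchSwinnertonDyer.BirchSwinnertonDyer.Theorems.SmallImageMuTransferMuTransferX9KolyvaginValueAssembled
import Summits.BirchSwinnertonDyer.BirchSwinnertonDyer.Theorems.SmallImageMuTransferMuTransferX9StepTwoElement
import HarnessLib

/-!
# Route ByReductionTypeAtTwo, crux `OrdKatoHalfAtTwoIso` (stmt-BirchSwinnertonDyer-19573), line `steinberg-fibre-at-two`,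
# registered stub `stub_HK_kolyvaginRankOneTwo` (Ω2 = H-K), interior step (E): the KOLYVAGIN PACKAGE AT `p = 2` —
# the Kolyvagin cocycle `κ_q` of ONE transposition prime with its VALUE `κ_q(τ_q) = T^a·((Fr_q − 1)·κ'(Fr_q))`

Seat `cruxlead-stmt-BirchSwinnertonDyer-19573-g0` (LEAD PROVER, MODE LINE; HOME `run/shared/lean/pub/bsd-2adic/`).
THEOREMS ONLY. HONEST FRAMING (cell bsd-2adic): BSD is not proved by any of this; the crux is not proved;
`--supports` helper toward the lead's registered research stub `stub_HK_kolyvaginRankOneTwo : KolyvaginRankOneTwo`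
(skeleton v7), closing nothing. The `p = 2`, TRANSPOSITION-prime twin of the odd kernel's `TameClass.exists_kolyvaginPackage`
(`Theorems/SmallImageMuTransferMuTransferX9KolyvaginPackage.lean:69–243`), composed from landed `p = 2` pieces: the value
input `exists_tameCocycle_valueInput_two` (p662529; H16 at 2 p660933 + Euler factor mod 2 p661875), the wave-4
worker's hp2-free Kolyvagin cocycle `KolyvaginTwist.exists_kolyvaginCocycle_value_noTransverse` (p661924), the lead's
K3 value line `KThree.neg_castLE_eq_shiftEnd_pow_compLeft_sub` (p660967), the tower-class unramifiedness (I0)₂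
(`RedTowerTwo.localization_redTower_mem_unramifiedSubgroup`, p663059), the local-Frobenius transport
(`LocalFrobenius.galoisRepTorsion_absGaloisRestrict_of_isArithFrobAt`, p664103), and H-F in its `E(ℚ^{ab})[2] = 0` form
(`geomTorsion_eq_zero_of_fixed_of_commutator_le_two`, p658988). DIFFERENCES from the odd package: level `L = 2^{d+2}`
for a Frobenius of exact depth `d` and `J ≤ 2ᵈ` (the K3 margin `J + 2^{d+1} ≤ L`); NO transversality clause (false at
2); the VALUE is `c(res τq) = S^a((res r)·Φ(res r) − Φ(res r))` with NO unit polynomial (`N² = (φ̃−1)²` makes the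
division exact, K3).

References: B. Mazur, K. Rubin, Mem. AMS 799 (2004) §1.2, Prop. 1.3.2 [MazurRubin2004]; K. Rubin, *Euler Systems* (2000)
Def. 4.4.4, Lemma 4.4.2, Thm. 4.5.1/4.5.4 [Rubin2000]; K. Kato, Astérisque 295 (2004) §13.1 (13.1.1), Ex. 13.3
[Kato2004Asterisque]; L. Washington, *Introduction to Cyclotomic Fields* §13.2 [Washington1997].
-/

set_option linter.dupNamespace false
set_option autoImplicit false

noncomputable section

open CategoryTheory Function Finset Polynomial
open scoped NumberField Pointwise
open Field IsDedekindDomain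
open Literature.NumberTheory.GaloisRepresentations
open Literature.NumberTheory.GaloisCohomology
open Literature.NumberTheory.EllipticCurves
open Literature.NumberTheory.EllipticCurves.ZpExtension
open Literature.NumberTheory.EllipticCurves.Kato2004
open Literature.NumberTheory.EllipticCurves.Kato2004.EulerSystemValues
open Rat.HeightOneSpectrum
open Summit.BirchSwinnertonDyer.Rank1Residual.GaloisImage
open Summit.BirchSwinnertonDyer.BirchSwinnertonDyer.Rank1Residual

namespace Summit.BirchSwinnertonDyer.BirchSwinnertonDyer.Theorems.SteinbergFibreAtTwo

variable (W : WeierstrassCurve ℚ) [W.IsElliptic] [W.IsGloballyMinimal]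
  [ContinuousSMul ℤ_[2] (W.tateModule 2)]
  [Module.Free ℤ_[2] (W.tateModule 2)] [Module.Finite ℤ_[2] (W.tateModule 2)]
  (κ : ZpExtension ℚ 2) (hκ : κ.IsCyclotomic) (γ : absoluteGaloisGroup ℚ) (I : IwasawaH1Data W 2 κ γ)

/-- **The Kolyvagin package at `p = 2`, at ONE transposition prime** (Ω2 interior (E); the `p = 2` twin of
`TameClass.exists_kolyvaginPackage`). For `ρ̄_{E,2}` onto and a genuine `2`-adic Euler-system class `s` there is a finite
`S₀` such that: for the stub's `a`, `κ'` with `T^{[a]} κ' = 𝐳̄ = red_Ω s`, a depth `d` and a level `J ≤ 2ᵈ`, a cocycle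
`Φ` of `κ'_J`, a place `q ∉ S₀` with the usual instances, `𝔓 ∣ q` and an arithmetic Frobenius `Fr` at `𝔓` with
`ρ̄₂(Fr)² = 1`, `ρ̄₂(Fr) ≠ 1` and `Fr ∈ Γ^{2ᵈ} ∖ Γ^{2^{d+1}}`: (I0) `loc_q (𝐳̄_J)` is unramified, and there are a GLOBAL
cocycle `c` of `𝒯_J(E)` (the Kolyvagin class `κ_q`), a tame generator `τq ∈ I_{ℚ_q}` whose mod-`ℓ` cyclotomic character
generates, a local arithmetic Frobenius `r`, with `loc_w [c]` unramified at every `w ≠ q`, `w ∤ 2`, `E[2]` unramified at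
`w`, and the VALUE `c(res τq) = S^a((res r)·Φ(res r) − Φ(res r))`.
[cite: Rubin2000, Def. 4.4.4, Lemma 4.4.2 and Thm. 4.5.4] [cite: MazurRubin2004, §1.2 and Prop. 1.3.2]
[cite: Kato2004Asterisque, §13.1 (13.1.1) and Ex. 13.3] -/
theorem exists_kolyvaginPackage_two (h2 : W.HasSurjectiveModNGaloisRep 2) {s : I.H}
    (hES : IsEulerSystemClassTwo W hκ I s) :
    ∃ S₀ : Set (HeightOneSpectrum (𝓞 ℚ)), S₀.Finite ∧
      ∀ (a : ℕ) (κ' : κ.twistTower (W.torsionGaloisModule ((2 : ℕ) : ℤ))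
          (fun P : WeierstrassCurve.geomTorsion W ((2 : ℕ) : ℤ) => AddSubgroup.torsionBy.nsmul P)),
        (κ.towerShift (W.torsionGaloisModule ((2 : ℕ) : ℤ))
          (fun P : WeierstrassCurve.geomTorsion W ((2 : ℕ) : ℤ) => AddSubgroup.torsionBy.nsmul P))^[a] κ' =
            I.redTower s →
      ∀ (d J : ℕ), J ≤ 2 ^ d →
      ∀ (Φ : contOneCocycles (W.modPTwist 2 κ J).toTopRep),
        oneCocycleClass (W.modPTwist 2 κ J).toTopRep Φ = κ'.1 J →
      ∀ (q : HeightOneSpectrum (𝓞 ℚ)), q ∉ S₀ →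
      ∀ [NeZero ((primesEquiv q : Nat.Primes) : ℕ)] [Fact (((primesEquiv q : Nat.Primes) : ℕ)).Prime]
        [NeZero ((((primesEquiv q : Nat.Primes) : ℕ) : ℕ) : q.adicCompletion ℚ)]
        [(rootsOfUnityFixer ℚ ((primesEquiv q : Nat.Primes) : ℕ)).Normal]
        [Fintype (absoluteGaloisGroup ℚ ⧸ rootsOfUnityFixer ℚ ((primesEquiv q : Nat.Primes) : ℕ))],
      ∀ 𝔓 ∈ q.primesAbove, ∀ (Fr : absoluteGaloisGroup ℚ), IsArithFrobAt (𝓞 ℚ) Fr 𝔓 →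
        WeierstrassCurve.galoisRepTorsion W 2 (Fr * Fr) = 1 → WeierstrassCurve.galoisRepTorsion W 2 Fr ≠ 1 →
        Fr ∈ κ.layerSubgroup d → Fr ∉ κ.layerSubgroup (d + 1) →
      galoisCohomology.localization (W.modPTwist 2 κ J) (Sum.inr q) 1 ((I.redTower s).1 J) ∈
        DiscreteGaloisModule.unramifiedSubgroup (GaloisRep.toLocal q (W.modPTwist 2 κ J)) 1 ∧
      ∃ (c : contOneCocycles (W.modPTwist 2 κ J).toTopRep)
        (τq r : absoluteGaloisGroup (q.adicCompletion ℚ)),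
        τq ∈ absInertia (q.adicCompletion ℚ) ∧
        (∀ u : (ZMod ((primesEquiv q : Nat.Primes) : ℕ))ˣ,
          u ∈ Subgroup.zpowers (modPCyclotomicCharacterZMod (q.adicCompletion ℚ)
            ((primesEquiv q : Nat.Primes) : ℕ) τq)) ∧
        (∀ w : HeightOneSpectrum (𝓞 ℚ), w ≠ q → ((2 : ℕ) : 𝓞 ℚ) ∉ w.asIdeal →
          GaloisRep.IsUnramifiedAt w (W.torsionGaloisModule ((2 : ℕ) : ℤ)) →
          galoisCohomology.localization (W.modPTwist 2 κ J) (Sum.inr w) 1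
              (oneCocycleClass (W.modPTwist 2 κ J).toTopRep c) ∈
            DiscreteGaloisModule.unramifiedSubgroup (GaloisRep.toLocal w (W.modPTwist 2 κ J)) 1) ∧
        IsAbsArithFrob r ∧
        c.1 (absGaloisRestrict ℚ (q.adicCompletion ℚ) τq) =
          (shiftEnd (WeierstrassCurve.geomTorsion W ((2 : ℕ) : ℤ)) J ^ a)
            (W.modPTwist 2 κ J (absGaloisRestrict ℚ (q.adicCompletion ℚ) r)
              (Φ.1 (absGaloisRestrict ℚ (q.adicCompletion ℚ) r)) -
             Φ.1 (absGaloisRestrict ℚ (q.adicCompletion ℚ) r)) := by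
  classical
  haveI : Fact (2 : ℕ).Prime := ⟨Nat.prime_two⟩
  obtain ⟨S₀, hS₀, hmain⟩ := exists_tameCocycle_valueInput_two W κ hκ γ I hES
  refine ⟨S₀, hS₀, ?_⟩
  intro a κ' hκ' d J hJd Φ hΦ q hq _ _ _ _ _ 𝔓 h𝔓 Fr hFr hT hT1 hFrd hFrd'
  -- levels: `J ≤ 2ᵈ`, `L = 2^{d+2}`, `J + 2^{d+1} ≤ L`, `J ≤ 2·2ᵈ`
  have h2d : 2 ^ (d + 2) = 2 ^ d + 2 ^ d + 2 ^ (d + 1) := by rw [pow_succ, pow_succ]; ring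
  have hJL : J ≤ 2 ^ (d + 2) := by rw [h2d]; omega
  have hJL' : J + 2 ^ (d + 1) ≤ 2 ^ (d + 2) := by rw [h2d]; omega
  have hJ2 : J ≤ 2 * 2 ^ d := by omega
  obtain ⟨hqp, hunr, hdvd, u, y', hu, hact, hyI', hrel⟩ := hmain q hq h𝔓 hFr hT hFrd hFrd'
  have hqp' : ((2 : ℕ) : 𝓞 ℚ) ∉ q.asIdeal := hqp
  refine ⟨RedTowerTwo.localization_redTower_mem_unramifiedSubgroup W κ hκ γ I hES hqp' hunr J, ?_⟩
  -- a cocycle of `𝐳̄₁` at level `L` and the norm relation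
  obtain ⟨φ, hφ⟩ := oneCocycleClass_surjective _ ((I.redTower s : ∀ J : ℕ, galoisCohomology
    (κ.twistModP (W.torsionGaloisModule ((2 : ℕ) : ℤ)) IwasawaH1Data.torsion_nsmul_eq_zero J) 1)
    (2 ^ (d + 2)))
  obtain ⟨ψ', hψ', hnorm, hψJ⟩ := hrel φ hφ
  -- H-F: `E(ℚ^{ab})[2] = 0` for `ρ̄₂` onto
  have hfix : ∀ m : WeierstrassCurve.geomTorsion W ((2 : ℕ) : ℤ),
      (∀ g ∈ rootsOfUnityFixer ℚ ((primesEquiv q : Nat.Primes) : ℕ),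
        W.torsionGaloisModule ((2 : ℕ) : ℤ) g m = m) → m = 0 := fun m hm =>
    geomTorsion_eq_zero_of_fixed_of_commutator_le_two W h2 (commutator_le_rootsOfUnityFixer ℚ _) m
      fun σ hσ => by rw [← WeierstrassCurve.torsionGaloisModule_apply_apply]; exact hm σ hσ
  -- the hp2-free Kolyvagin cocycle with its value (wave 4, M1)
  obtain ⟨σ, hσ, τq, hτq, hτqσ, hgen, -, c, hx, -, r, hr, -, a', hval, hkey⟩ :=
    KolyvaginTwist.exists_kolyvaginCocycle_value_noTransverse κ (W.torsionGaloisModule ((2 : ℕ) : ℤ))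
      IwasawaH1Data.torsion_nsmul_eq_zero J q hfix hqp hunr hdvd hJL y' hyI' ψ' hnorm (hψJ hJL hJ2)
  refine ⟨c, τq, r, hτq, hgen, hx, hr, ?_⟩
  -- the local Frobenius `res r`: a transposition of depth `d`, its slotwise action `τ` with `τ² = 1`
  set rr := absGaloisRestrict ℚ (q.adicCompletion ℚ) r with hrrdef
  obtain ⟨hrr2, -, hrrlayer⟩ :=
    LocalFrobenius.galoisRepTorsion_absGaloisRestrict_of_isArithFrobAt W κ hunr hqp' h𝔓 hFr hT hT1 hr
  have hrrd : rr ∈ κ.layerSubgroup d := (hrrlayer d).2 hFrd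
  let τ : WeierstrassCurve.geomTorsion W ((2 : ℕ) : ℤ) →ₗ[ℤ] WeierstrassCurve.geomTorsion W ((2 : ℕ) : ℤ) :=
    (DistribSMul.toAddMonoidHom (WeierstrassCurve.geomTorsion W ((2 : ℕ) : ℤ)) rr).toIntLinearMap
  have hτx : ∀ (n : ℕ) (x : Fin n → WeierstrassCurve.geomTorsion W ((2 : ℕ) : ℤ)),
      τ.compLeft (Fin n) x = fun i => rr • x i := fun _ _ => rfl
  have hτ : τ * τ = 1 := by
    refine LinearMap.ext fun P => ?_
    change rr • (rr • P) = P
    rw [← mul_smul]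
    exact forall_smul_eq_of_galoisRepTorsion_eq_one W 2 hrr2 P
  -- the key relation in K3 shape: `(φ̃ τ − 1) a' = −(φ̃ − 1)² φ(res r)`
  have hM : ∀ x : WeierstrassCurve.geomTorsion W ((2 : ℕ) : ℤ), 2 • x = 0 := IwasawaH1Data.torsion_nsmul_eq_zero
  have hkey' : (unipotentPow (WeierstrassCurve.geomTorsion W ((2 : ℕ) : ℤ)) (2 ^ (d + 2)) (2 ^ d * u) *
        τ.compLeft (Fin (2 ^ (d + 2))) - 1) a' =
      -((unipotentPow (WeierstrassCurve.geomTorsion W ((2 : ℕ) : ℤ)) (2 ^ (d + 2)) (2 ^ d * u) - 1)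
        ((unipotentPow (WeierstrassCurve.geomTorsion W ((2 : ℕ) : ℤ)) (2 ^ (d + 2)) (2 ^ d * u) - 1)
          (φ.1 rr))) := by
    have hact' : ∀ x : Fin (2 ^ (d + 2)) → WeierstrassCurve.geomTorsion W ((2 : ℕ) : ℤ),
        κ.twistModP (W.torsionGaloisModule ((2 : ℕ) : ℤ)) IwasawaH1Data.torsion_nsmul_eq_zero (2 ^ (d + 2)) rr x =
          unipotentPow (WeierstrassCurve.geomTorsion W ((2 : ℕ) : ℤ)) (2 ^ (d + 2)) (2 ^ d * u)
            (fun i => rr • x i) := fun x => hact r hr x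
    have h1 : (unipotentPow (WeierstrassCurve.geomTorsion W ((2 : ℕ) : ℤ)) (2 ^ (d + 2)) (2 ^ d * u) *
        τ.compLeft (Fin (2 ^ (d + 2)))) a' =
        κ.twistModP (W.torsionGaloisModule ((2 : ℕ) : ℤ)) IwasawaH1Data.torsion_nsmul_eq_zero (2 ^ (d + 2)) rr a' := by
      rw [Module.End.mul_apply, hτx, hact']
    have hψ'' : ψ'.1 rr =
        (unipotentPow (WeierstrassCurve.geomTorsion W ((2 : ℕ) : ℤ)) (2 ^ (d + 2)) (2 ^ d * u) - 1)
          ((unipotentPow (WeierstrassCurve.geomTorsion W ((2 : ℕ) : ℤ)) (2 ^ (d + 2)) (2 ^ d * u) - 1)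
            (φ.1 rr)) := hψ' rr
    rw [LinearMap.sub_apply, Module.End.one_apply, h1, hkey, hψ'']
  -- the coboundary `φ mod T^J − S^a Φ = (res r)·b − b`, and `(res r)` acts slotwise at level `J ≤ 2ᵈ`
  obtain ⟨b, hb⟩ := KolyvaginTwist.exists_coboundary_apply_of_towerShift_iterate_eq κ
    (W.torsionGaloisModule ((2 : ℕ) : ℤ)) IwasawaH1Data.torsion_nsmul_eq_zero κ' (I.redTower s) hκ' hJL Φ hΦ φ hφ
  have htwJ : ∀ x : Fin J → WeierstrassCurve.geomTorsion W ((2 : ℕ) : ℤ),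
      W.modPTwist 2 κ J rr x = τ.compLeft (Fin J) x := fun x => by
    rw [hτx]
    exact modPTwist_apply_of_mem_layerSubgroup_of_le W 2 κ hJd hrrd x
  have hcob : (fun i : Fin J => φ.1 rr (Fin.castLE (le_trans (Nat.le_add_right J (2 ^ (d + 1))) hJL') i)) -
      (shiftEnd (WeierstrassCurve.geomTorsion W ((2 : ℕ) : ℤ)) J ^ a) (Φ.1 rr) = τ.compLeft (Fin J) b - b := by
    rw [← htwJ]
    exact hb rr
  -- K3: the division and the coboundary correction
  have hK3 := KThree.neg_castLE_eq_shiftEnd_pow_compLeft_sub hM d u hu τ hτ hJd hJL' a' (φ.1 rr) hkey' a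
    (Φ.1 rr) b hcob
  rw [hval]
  rw [htwJ]
  exact hK3

end Summit.BirchSwinnertonDyer.BirchSwinnertonDyer.Theorems.SteinbergFibreAtTwo

end
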